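import Literature.Analysis.FluidPDE.HouLeiLiEstimate
import HarnessLib

/-!
# The Hessian–Laplacian identity `∫ Σᵢⱼ (∂ⱼ∂ᵢG)² = ∫ (ΔG)²` for square-integrable derivatives

Analysis/FluidPDE proof file (theorems only; no definitions, no named facts) on the way to
`Literature.Analysis.FluidPDE.Wei2016_logModulus_regularity`
(`LeiZhang2017AxisymmetricCriteria.lean`). D. Wei, J. Math. Anal. Appl. 435 (2016) =
arXiv:1508.03318, proof of Lemma 2.1 and (3.5), uses
"`‖Δ(u_r/r)‖²_{L²} = ‖∇²(u_r/r)‖²_{L²}`" and "`∫|∂ᵣ∇(u_r/r)|² ≤ ‖∇²(u_r/r)‖²_{L²} ≤ ‖∂_zΩ‖²_{L²}`"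
for the smooth, square-integrable quotient `u_r/r` of the strong solution. The tree has the
identity `Σᵢⱼ ∫ (∂ⱼ∂ᵢG)² = ∫ (ΔG)²` for compactly supported `G`
(`integral_sum_sq_fderiv_fderiv_eq_integral_laplacian_sq`, `HessianLaplacian.lean`); this file
proves it under square-integrability of `∂G, ∂²G, ∂³G` instead (two whole-space integrations by
parts with integrable data, Mathlib's `integral_mul_fderiv_eq_neg_fderiv_mul_of_integrable`):

* `Wei2016.integral_sq_fderiv_fderiv_eq` — `∫ (∂ⱼ∂ᵢG)² = ∫ ∂ᵢ∂ᵢG · ∂ⱼ∂ⱼG` (`G ∈ C³`);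
* `Wei2016.integral_sum_sq_fderiv_fderiv_eq_integral_laplacian_sq_of_memLp` —
  `∫ Σᵢⱼ (∂ⱼ∂ᵢG)² = ∫ (ΔG)²`.

## References

* D. Wei, arXiv:1508.03318, proof of Lemma 2.1 ("`‖Δ(u_r/r)‖² = ‖∇²(u_r/r)‖²`") and (3.5).
  [Wei2016]
* D. Gilbarg, N. S. Trudinger, *Elliptic PDE of second order*, proof of Thm. 9.9 (the `L²`
  identity by two integrations by parts). [folklore]
-/

noncomputable section

open MeasureTheory Set Function Filter Topology
open scoped ENNReal Laplacian

namespace Literature.Analysis.FluidPDE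

namespace Wei2016

variable {G : EuclideanSpace ℝ (Fin 3) → ℝ}

/-- **`∫ (∂ⱼ∂ᵢG)² = ∫ ∂ᵢ∂ᵢG · ∂ⱼ∂ⱼG`** on `ℝ³` for `G ∈ C³` with `∂ᵢG`, all second and the
relevant third partial derivatives in `L²`: integrate by parts in `xⱼ`
(`∫ ∂ⱼ(∂ᵢG) ∂ⱼ(∂ᵢG) = −∫ ∂ᵢG ∂ⱼ∂ⱼ∂ᵢG`), commute `∂ⱼ∂ⱼ∂ᵢ = ∂ᵢ∂ⱼ∂ⱼ`, and integrate by parts in `xᵢ`.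
[folklore] -/
theorem integral_sq_fderiv_fderiv_eq (hG : ContDiff ℝ 3 G) (i j : Fin 3)
    (h1 : ∀ k : Fin 3, MemLp (fun x => fderiv ℝ G x (EuclideanSpace.single k 1)) 2 volume)
    (h2 : ∀ k l : Fin 3, MemLp (fun x => fderiv ℝ (fun y => fderiv ℝ G y (EuclideanSpace.single k 1)) x
      (EuclideanSpace.single l 1)) 2 volume)
    (h3 : ∀ k l m : Fin 3, MemLp (fun x => fderiv ℝ (fun z => fderiv ℝ (fun y => fderiv ℝ G y
      (EuclideanSpace.single k 1)) z (EuclideanSpace.single l 1)) x (EuclideanSpace.single m 1)) 2 volume) :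
    ∫ x, fderiv ℝ (fun y => fderiv ℝ G y (EuclideanSpace.single i 1)) x (EuclideanSpace.single j 1) ^ 2 =
      ∫ x, fderiv ℝ (fun y => fderiv ℝ G y (EuclideanSpace.single i 1)) x (EuclideanSpace.single i 1) *
        fderiv ℝ (fun y => fderiv ℝ G y (EuclideanSpace.single j 1)) x (EuclideanSpace.single j 1) := by
  set e : Fin 3 → EuclideanSpace ℝ (Fin 3) := fun k => EuclideanSpace.single k 1 with he
  -- names for the partial derivatives
  set Gi : EuclideanSpace ℝ (Fin 3) → ℝ := fun y => fderiv ℝ G y (e i) with hGi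
  set Gj : EuclideanSpace ℝ (Fin 3) → ℝ := fun y => fderiv ℝ G y (e j) with hGj
  set Gij : EuclideanSpace ℝ (Fin 3) → ℝ := fun x => fderiv ℝ Gi x (e j) with hGij
  set Gjj : EuclideanSpace ℝ (Fin 3) → ℝ := fun x => fderiv ℝ Gj x (e j) with hGjj
  set Gii : EuclideanSpace ℝ (Fin 3) → ℝ := fun x => fderiv ℝ Gi x (e i) with hGii
  have hG2 : ContDiff ℝ 2 G := hG.of_le (by norm_num)
  have hGi2 : ContDiff ℝ 2 Gi := contDiff_fderiv_apply_const_succ (n := 2) (by exact_mod_cast hG) _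
  have hGj2 : ContDiff ℝ 2 Gj := contDiff_fderiv_apply_const_succ (n := 2) (by exact_mod_cast hG) _
  have hGij1 : ContDiff ℝ 1 Gij := contDiff_fderiv_apply_const_succ (n := 1) (by exact_mod_cast hGi2) _
  have hGjj1 : ContDiff ℝ 1 Gjj := contDiff_fderiv_apply_const_succ (n := 1) (by exact_mod_cast hGj2) _
  have hGid : Differentiable ℝ Gi := hGi2.differentiable two_ne_zero
  have hGijd : Differentiable ℝ Gij := hGij1.differentiable one_ne_zero
  have hGjjd : Differentiable ℝ Gjj := hGjj1.differentiable one_ne_zero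
  -- `∂ⱼGjᵢ... `: the commutations `∂ⱼ(∂ᵢG) = ∂ᵢ(∂ⱼG)` and `∂ⱼ(∂ⱼ∂ᵢG) = ∂ᵢ(∂ⱼ∂ⱼG)`
  have hcomm1 : ∀ x, Gij x = fderiv ℝ Gj x (e i) := fun x =>
    fderiv_fderiv_apply_comm_vec_scalar hG2 x (e i) (e j)
  have hcomm2 : ∀ x, fderiv ℝ Gij x (e j) = fderiv ℝ Gjj x (e i) := by
    intro x
    -- `Gij = ∂ᵢ Gj` as functions, so `∂ⱼ Gij = ∂ⱼ∂ᵢ Gj = ∂ᵢ∂ⱼ Gj = ∂ᵢ Gjj`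
    have hfun : Gij = fun y => fderiv ℝ Gj y (e i) := funext hcomm1
    rw [hfun]
    exact fderiv_fderiv_apply_comm_vec_scalar hGj2 x (e i) (e j)
  -- first integration by parts, in `xⱼ`: `∫ Gij · ∂ⱼGi = −∫ ∂ⱼGij · Gi`
  have iA : Integrable (fun x => fderiv ℝ Gij x (e j) * Gi x) volume := by
    have h := (h3 i j j).integrable_mul (h1 i)
    exact h
  have iB : Integrable (fun x => Gij x * fderiv ℝ Gi x (e j)) volume := (h2 i j).integrable_mul (h2 i j)
  have iC : Integrable (fun x => Gij x * Gi x) volume := (h2 i j).integrable_mul (h1 i)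
  have hIBP1 := integral_mul_fderiv_eq_neg_of_differentiable hGijd hGid (e j) iA iB iC
  -- `∫ (Gij)² = ∫ Gij ∂ⱼGi`
  have hsq : ∫ x, Gij x ^ 2 = ∫ x, Gij x * fderiv ℝ Gi x (e j) :=
    integral_congr_ae (Eventually.of_forall fun x => by simp only [hGij]; ring)
  -- second integration by parts, in `xᵢ`: `∫ Gi · ∂ᵢGjj = −∫ ∂ᵢGi · Gjj`
  have iA' : Integrable (fun x => fderiv ℝ Gi x (e i) * Gjj x) volume := (h2 i i).integrable_mul (h2 j j)
  have iB' : Integrable (fun x => Gi x * fderiv ℝ Gjj x (e i)) volume := by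
    have h : Integrable (fun x => Gi x * fderiv ℝ Gij x (e j)) volume := (h1 i).integrable_mul (h3 i j j)
    refine h.congr (Eventually.of_forall fun x => ?_)
    simp only [hcomm2 x]
  have iC' : Integrable (fun x => Gi x * Gjj x) volume := (h1 i).integrable_mul (h2 j j)
  have hIBP2 := integral_mul_fderiv_eq_neg_of_differentiable hGid hGjjd (e i) iA' iB' iC'
  -- assemble
  calc ∫ x, Gij x ^ 2 = ∫ x, Gij x * fderiv ℝ Gi x (e j) := hsq
    _ = -∫ x, fderiv ℝ Gij x (e j) * Gi x := hIBP1
    _ = -∫ x, Gi x * fderiv ℝ Gjj x (e i) := by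
        congr 1
        exact integral_congr_ae (Eventually.of_forall fun x => by simp only [hcomm2 x]; ring)
    _ = ∫ x, fderiv ℝ Gi x (e i) * Gjj x := by rw [hIBP2, neg_neg]
    _ = ∫ x, Gii x * Gjj x := rfl

/-- **The Hessian–Laplacian identity `∫ Σᵢⱼ (∂ⱼ∂ᵢG)² = ∫ (ΔG)²`** on `ℝ³` for `G ∈ C³` with all
partial derivatives of orders `1, 2, 3` in `L²` (Wei: "`‖Δ(u_r/r)‖²_{L²} = ‖∇²(u_r/r)‖²_{L²}`").
[cite: Wei2016, proof of Lemma 2.1] -/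
theorem integral_sum_sq_fderiv_fderiv_eq_integral_laplacian_sq_of_memLp (hG : ContDiff ℝ 3 G)
    (h1 : ∀ k : Fin 3, MemLp (fun x => fderiv ℝ G x (EuclideanSpace.single k 1)) 2 volume)
    (h2 : ∀ k l : Fin 3, MemLp (fun x => fderiv ℝ (fun y => fderiv ℝ G y (EuclideanSpace.single k 1)) x
      (EuclideanSpace.single l 1)) 2 volume)
    (h3 : ∀ k l m : Fin 3, MemLp (fun x => fderiv ℝ (fun z => fderiv ℝ (fun y => fderiv ℝ G y
      (EuclideanSpace.single k 1)) z (EuclideanSpace.single l 1)) x (EuclideanSpace.single m 1)) 2 volume) :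
    ∫ x, ∑ i : Fin 3, ∑ j : Fin 3,
        fderiv ℝ (fun y => fderiv ℝ G y (EuclideanSpace.single i 1)) x (EuclideanSpace.single j 1) ^ 2 =
      ∫ x, (Δ G) x ^ 2 := by
  set e : Fin 3 → EuclideanSpace ℝ (Fin 3) := fun k => EuclideanSpace.single k 1 with he
  have hG2 : ContDiff ℝ 2 G := hG.of_le (by norm_num)
  set D : Fin 3 → EuclideanSpace ℝ (Fin 3) → ℝ := fun i x =>
    fderiv ℝ (fun y => fderiv ℝ G y (e i)) x (e i) with hD
  -- `(ΔG)² = Σᵢⱼ ∂ᵢ∂ᵢG ∂ⱼ∂ⱼG`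
  have hlap : ∀ x, (Δ G) x = ∑ i, D i x := fun x => by
    rw [laplacian_eq_sum_fderiv_fderiv (EuclideanSpace.basisFun (Fin 3) ℝ) hG2 x]
    simp only [EuclideanSpace.basisFun_apply, hD]
    rfl
  have hsqsum : ∀ x, (Δ G) x ^ 2 = ∑ i, ∑ j, D i x * D j x := fun x => by
    rw [hlap x, sq, Finset.sum_mul_sum]
  -- integrability of the individual terms
  have iSq : ∀ i j : Fin 3, Integrable (fun x =>
      fderiv ℝ (fun y => fderiv ℝ G y (e i)) x (e j) ^ 2) volume := fun i j => (h2 i j).integrable_sq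
  have iDD : ∀ i j : Fin 3, Integrable (fun x => D i x * D j x) volume := fun i j =>
    (h2 i i).integrable_mul (h2 j j)
  rw [integral_congr_ae (Eventually.of_forall hsqsum)]
  rw [integral_finsetSum _ fun i _ => integrable_finsetSum _ fun j _ => iSq i j,
    integral_finsetSum _ fun i _ => integrable_finsetSum _ fun j _ => iDD i j]
  refine Finset.sum_congr rfl fun i _ => ?_
  rw [integral_finsetSum _ fun j _ => iSq i j, integral_finsetSum _ fun j _ => iDD i j]
  refine Finset.sum_congr rfl fun j _ => ?_
  exact integral_sq_fderiv_fderiv_eq hG i j h1 h2 h3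

end Wei2016

end Literature.Analysis.FluidPDE

end
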